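import Summits.QuantumFields.BalabanUV.Beta.FP.PerfectGaugeDefectBottomDressed
import Summits.QuantumFields.BalabanUV.Beta.FP.NestedDressingLinear

/-!
# `BalabanUV.Beta.FP.NestedDressingDefectKill` — road «FP» for binder row D1, W-ORACLE-K row **SPLIT, part (i-a)** (owner d1-p3 gen 15, memo
# `HOME/b2b-balaban-beta-d1-p3/N2B-DESIGN.md` v3.1 §11 (11b) (i); journal [D1P3-G15-WORACLEK]): **THE NESTED PROJECTOR KILLS THE FINITE-`j` BOTTOM
# TWO-LEVEL DEFECT, ENTRYWISE, AT EVERY `j`** — for `Π := piKSymNest (toSite r) Lc (m+1)` (leaf-06 FILE 4) and the BARE finite-`j` bottom defect `E_j` of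
# `PerfectGaugeDefectBottomLimit` ∕ `…Dressed` (gan24-leaf-05, SPLIT (i-b)), the double window contraction `Σ_{v,κ} Σ_{w,l} Π̂_{a,x;κ,x−v} · E_j(x−v, z−w; κ, l) · Π̂_{b,z;l,z−w}`
# VANISHES: in the closed form of `TwoLevelDefectClosedForm` every term carries the pure gauge `β_{y₀} = −dz θ_{y₀}`, `θ_{y₀} ∈ Θ_{N′}`, on exactly one leg; the
# `Lc^j`-decimation of that leg is `−dz (blockSum (Lc^j) θ_{y₀})`, a gradient of zero `Lc^(m+1)`-block sums on the step-`j` lattice, which `Π^{(m+1)}_nest` annihilates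
# (FILE 1 `symAxProjNestAt_grad_eq_zero_of_blockSum`, read on columns through FILE 7 `symAxProjNestAt_eq_coProjNestAt`); HENCE (§4, with (i-b)) **SPLIT (i):
# `[Πᵀ∘E♭_m∘Π]_ff = 0` FOR THE PERFECT BOTTOM DEFECT, UNCONDITIONALLY** (`d + 1 = 4`, `Lc ≥ 2`, `m ≥ 1`)

HONEST DEPENDENCY (page 1, mandatory): continuum YM on T⁴ ⇐ BetaPertH ∧ nine spine estimates (0/9 proved); BetaPertH ⇐ (D1) ∧ (D4) ∧ CAP+tail;
G-an2-4 gates asym, D1 and NE2/3/4.  HONEST FRAMING (cell contract, verbatim): «discharging `BetaPertH` makes Bałaban's UV stability UNCONDITIONAL —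
a real constructive-QFT result; it is NOT the continuum limit and NOT the Clay problem.»  THIS MODULE is [folklore] finite sums + ONE Fubini (finite sums against
the absolutely convergent `Σ'_{y₀}` of `TwoLevelDefectClosedForm`) over LANDED rows: the owner's `TwoLevelDefectClosedForm.twoLevelDefect_closedForm` ∕
`GaugeMultiplierBiLaplace.blockSum_Mcol_eq_neg_dz` ∕ `blockSum_theta`, gan24-leaf-05's `PerfectGaugeDefectBottomLimit.bareDefectBottom_ff_eq_sum_closedForm`,
gan24-leaf-04's `blockSum_mul`, this lineage's FILES 1∕3∕4∕7 (`symAxProjNestAt_grad_eq_zero_of_blockSum`, `symAxProjNestAt_smul`, `pmSymNest`, `symAxProjNestAt_eq_coProjNestAt`).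
No `def`, no `def … : Prop`, nothing cited, nothing of Bałaban's asserted, 0 sorry; 0 estimates of Bałaban's constrained objects; 0∕4 row-D1 binders; (i-b) is gan24-leaf-05's (✓ p297974 ∕ p299552, consumed BY NAME in §4); NOT the
fm∕mf∕mm blocks, NOT SPLIT (ii)(iii), NOT `G_N = G₁ + G_c`, NOT (SDF), NOT D1, NOT `BetaPertH`, NOT continuum, NOT Clay.  «not in print; our bookkeeping».

ABSOLUTE RULE (cell charter, verbatim): «No internally-minted statement may enter as a cited fact. Every hypothesis is either kernel-proved in
this package or a verbatim quotation of a PUBLISHED theorem with page reference. The manuscript(s) under audit are NOT citable for their own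
disputed steps — they are the thing under adjudication; programme-internal (2001/route/tribunal) claims are never citable.»

WHY (§11 (11b) (i)).  Row SPLIT wants the kernel identity `G_N = G₁ + G_c` for the Π-dressed perfect `(m+1)`-fold resolvent; its ff content is `Π·E♭_m·Πᵀ = 0`
for the perfect bottom defect `E♭_m` (owner's `PerfectGaugeDefectBottom`).  gan24-leaf-05's (i-b) reduced this to the BARE finite-`j` statement «the Π-windows of
`E_j` vanish for all large `j`» (`perfectDefectBottom_window_eq_zero_holds`, Π entering as two finite coefficient families) and wrote `E_j` in the owner's closed
form (`bareDefectBottom_ff_eq_sum_closedForm`): at `(M, N′) = (Lc^(j+1), Lc^(j+1+m))`,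
`E_j(x′,y′;κ,l) = Σ_{i,i′} c⁻² Σ'_{y₀} [C_{y₀}(κ,p_i)·β_{y₀}(l,q_{i′}) + β_{y₀}(κ,p_i)·C_{y₀}(l,q_{i′})]` (`c = (Lc^j)^{d+2}`, `p_i ∕ q_{i′}` the fine leg points of the
`Lc^j`-blocks `x′ ∕ y′`).  THIS FILE is (i-a): (§1) the decimated gauge leg `Σ_{i′} β_{y₀}(l, q_{i′}) = −(dz (blockSum (Lc^j) θ_{y₀}))(l, y′)` (`sum_LegIdx_eq_contourSum`,
`contourSum_dz`) has a potential of zero `Lc^(m+1)`-block sums on the step-`j` lattice (`blockSum_mul` + `blockSum_theta`: `Lc^j·Lc^(m+1) = N′`), so `Π^{(m+1)}_nest`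
KILLS it (FILE 1); (§2) Fubini puts `E_j` in the factorised form `Σ'_{y₀} [D_{y₀}(κ,x′)·B_{y₀}(l,y′) + B_{y₀}(κ,x′)·D_{y₀}(l,y′)]`; (§3) the double window contraction with
the matrix `pmSymNest` of `Π^{(m+1)}` is, leg by leg, `Π^{(m+1)}` applied to a column (FILE 7): the right contraction kills `D⊗B`, the left one `B⊗D`, term by term
under `Σ'_{y₀}` — at EVERY `j`, not only eventually.  The corollary in the `comp (comp (trK Π) ·) Π` currency is gan24-leaf-05's `coDressNest_ff_apply` (to land)
applied to this window identity; (i-b)'s `h0` is this identity with `p := Π̂_{a,x;·,·}`, `q := Π̂_{b,z;·,·}` over the two windows.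

CONTENT (generic `d`; `Lc ≥ 1`, in-block root `r ∈ box (d+1) Lc` where stated; `θ_{y₀} u := Σ_{b ∈ box (d+1) M} SbCol_{N′} (M•y₀ + b) u` written inline).
* §1 **`sum_LegIdx_blockSumMcol_eq_neg_dz`** (the decimated gauge leg is `−dz (blockSum K θ_{y₀})`), **`blockSum_blockSum_theta_eq_zero`** (`N′ = K·L ⇒ blockSum L (blockSum K θ_{y₀}) = 0`),
  **`symAxProjNestAt_decGaugeLeg_eq_zero`** (THE KILL: `Π^{(m+1)}_nest` annihilates `c • ` the decimated gauge leg when `N′ = Lc^j·Lc^(m+1)`),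
  `coProjNestAt_decGaugeLeg_eq_zero` (the same for the windowed matrix action, FILE 7).
* §2 `summable_term` ∕ **`bareDefectBottom_ff_eq_tsum_factorised`**: `E_j(x′,y′;κ,l) = Σ'_{y₀} [D·B + B·D]` with `D_{y₀}(κ,x′) := c⁻¹·Σ_i C_{y₀}(κ,p_i)`,
  `B_{y₀}(l,y′) := c⁻¹·Σ_{i′} β_{y₀}(l,q_{i′})`.
* §3 **`window_bareDefectBottom_eq_zero`** — THE MAIN THEOREM: for every `j m x z a b`,
  `Σ_{v ∈ cube (Lc^(m+1))} Σ_κ Σ_{w ∈ cube (Lc^(m+1))} Σ_l pmSymNest (toSite r) Lc (m+1) a x κ (x−v) · E_j(x−v, z−w; κ, l) · pmSymNest (toSite r) Lc (m+1) b z l (z−w) = 0`.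
* §4 **`coDressNest_bareDefectBottom_ff_eq_zero`** (every `j`, every `d`: `[Πᵀ∘E_j∘Π]_ff = 0`, gan24-leaf-05's `coDressNest_ff_apply` + §3) and
  **`coDressNest_perfectDefectBottom_ff_eq_zero`** (`d + 1 = 4`, `Lc ≥ 2`, `m ≥ 1`; UNCONDITIONAL): `[Πᵀ∘E♭_m∘Π](x,z; inl a, inl b) = 0` for the owner's PERFECT bottom
  defect — SPLIT (i) `Π·E♭_m·Πᵀ = 0` in the ff block, by (i-b)'s `coDressNest_perfectDefectBottom_ff_eq_zero_holds` with `h0` supplied at every `j`.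
Unit `b2b-balaban-beta-d1-formalise-leaf-06` (gen 15; FILES 1–7 of row NESTED-DRESS are this lineage's gen 14), road «FP» row SPLIT (i-a) (journal «MINE» 2026-08-21 [D1LEAF06-G15-MINE-1]).
-/

noncomputable section

namespace Summit.QuantumFields.BalabanUV.Beta.FP.NestedDressingDefectKill

open Finset Filter Topology
open scoped BigOperators
open Literature.MathematicalPhysics.QuantumFieldTheory
open Literature.MathematicalPhysics.QuantumFieldTheory.Balaban1983to89
open Literature.MathematicalPhysics.QuantumFieldTheory.Balaban1983to89.Beta
open AffineAveraging (Form0 Form1 Site unitVec dz codiff₁ box toSite blockSum contourSum contourSum_dz)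
open AveragingContours (grad grad_eq_dz)
open ExpKernelCalculus (MKer comp)
open OneStepResolventKernel (Fib)
open InterLevelTransport (liftW)
open KKTFluctuationEnergy (Gcol Mcol summable_mul_of_bdd summable_mul_of_bdd')
open OneStepKernelFamily (legPt LegIdx)
open StepDriftWitness (sum_LegIdx_eq_contourSum)
open BiLaplaceBlockGreen (SbCol)
open Summit.QuantumFields.BalabanUV.Beta.GAN24.PsiParentBlockMeans (blockSum_mul)
open Summit.QuantumFields.BalabanUV.Beta.AxialDressingRooted (cube)
open Summit.QuantumFields.BalabanUV.Beta.FP.PerfectObjects (KTot)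
open Summit.QuantumFields.BalabanUV.Beta.FP.GaugeMultiplierBiLaplace (blockSum_Mcol_eq_neg_dz blockSum_theta blockSumMcol_bdd_summable)
open Summit.QuantumFields.BalabanUV.Beta.FP.TwoLevelDefectClosedForm (summable_C)
open Summit.QuantumFields.BalabanUV.Beta.FP.PerfectObjectsT (KPerf)
open Summit.QuantumFields.BalabanUV.Beta.GAN24.CombesThomas (sfStep smStep)
open Summit.QuantumFields.BalabanUV.Beta.TameKernelCalculus (trK)
open Summit.QuantumFields.BalabanUV.Beta.FP.PerfectGaugeDefectBottomLimit (bareDefectBottom_ff_eq_sum_closedForm)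
open Summit.QuantumFields.BalabanUV.Beta.FP.PerfectGaugeDefectBottomDressed (coDressNest_ff_apply coDressNest_perfectDefectBottom_ff_eq_zero_holds)
open Summit.QuantumFields.BalabanUV.Beta.FP.NestedDressingProjector (symAxProjNestAt symAxProjNestAt_grad_eq_zero_of_blockSum)
open Summit.QuantumFields.BalabanUV.Beta.FP.NestedDressingProjectorBounds (symAxProjNestAt_smul)
open Summit.QuantumFields.BalabanUV.Beta.FP.NestedDressingKernel (pmSymNest piKSymNest)
open Summit.QuantumFields.BalabanUV.Beta.FP.NestedDressingLinear (coProjNestAt symAxProjNestAt_eq_coProjNestAt)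

variable {d : ℕ}

/-! ## §1 The decimated gauge leg is a gradient of zero `Lc^(m+1)`-block sums on the step-`j` lattice; the nested projector kills it -/

section GaugeLeg

variable {N' : ℕ} [NeZero N']

/-- [folklore] **THE DECIMATED GAUGE LEG**: summed over the field-leg points of the `K`-block `y′` (the straight `K`-contours), the `M`-block sum of the gauge
multiplier in its force leg is MINUS A COARSE GRADIENT: `Σ_{i′ ∈ LegIdx d K} blockSum M (Mcol_{N′} l (legPt K (inl l) y′ i′)) y₀ = −(dz (blockSum K θ_{y₀}))(l, y′)`,
`θ_{y₀} = Σ_{b ∈ box M} SbCol_{N′}(M•y₀ + b)` (`sum_LegIdx_eq_contourSum` + the owner's `blockSum_Mcol_eq_neg_dz` + `contourSum_dz`). -/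
theorem sum_LegIdx_blockSumMcol_eq_neg_dz (M K : ℕ) (l : Fin (d + 1)) (y' y₀ : Site (d + 1)) :
    ∑ i' ∈ LegIdx d K, blockSum M (Mcol (N := N') l (legPt K (Sum.inl l : Fib d) y' i')) y₀
      = -(dz (blockSum K (fun u => ∑ b ∈ box (d + 1) M, SbCol (N := N') ((M : ℤ) • y₀ + toSite b) u)) l y') := by
  rw [sum_LegIdx_eq_contourSum K l (fun l q => blockSum M (Mcol (N := N') l q) y₀) y']
  have e : contourSum K (fun l q => blockSum M (Mcol (N := N') l q) y₀) l y'
      = -(contourSum K (dz (fun u => ∑ b ∈ box (d + 1) M, SbCol (N := N') ((M : ℤ) • y₀ + toSite b) u)) l y') := by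
    simp only [contourSum, blockSum_Mcol_eq_neg_dz, Finset.sum_neg_distrib]
  rw [e, contourSum_dz]

/-- [folklore] **NESTED BLOCK SUMS OF THE GAUGE POTENTIAL VANISH**: if `N′ = K·L` (`K ≥ 1`) then `blockSum L (blockSum K θ_{y₀}) = 0` — `θ_{y₀}` has zero `N′`-block sums
(`blockSum_theta`) and `blockSum (K·L) = blockSum L ∘ blockSum K` (gan24-leaf-04's `blockSum_mul`). -/
theorem blockSum_blockSum_theta_eq_zero (M : ℕ) {K L : ℕ} (hK : 1 ≤ K) (hN : N' = K * L) (y₀ : Site (d + 1)) :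
    blockSum L (blockSum K (fun u => ∑ b ∈ box (d + 1) M, SbCol (N := N') ((M : ℤ) • y₀ + toSite b) u)) = 0 := by
  funext Y
  have h := blockSum_mul hK L (fun u => ∑ b ∈ box (d + 1) M, SbCol (N := N') ((M : ℤ) • y₀ + toSite b) u) Y
  rw [← hN, blockSum_theta] at h
  exact h.symm

/-- [our proof] **THE KILL**: for `N′ = Lc^j · Lc^(m+1)` (`Lc ≥ 1`, any root `ρ`, any weight `c`), the nested projector `Π^{(m+1)}_nest` ANNIHILATES the (weighted) decimated
gauge leg `(l, y′) ↦ c · Σ_{i′ ∈ LegIdx d (Lc^j)} blockSum M (Mcol_{N′} l (legPt (Lc^j) (inl l) y′ i′)) y₀` — it is `(−c) • grad` of a function of zero `Lc^(m+1)`-block sums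
(FILE 1 `symAxProjNestAt_grad_eq_zero_of_blockSum`, FILE 3 `symAxProjNestAt_smul`). -/
theorem symAxProjNestAt_decGaugeLeg_eq_zero {Lc : ℕ} (hLc : 1 ≤ Lc) (ρ : Site (d + 1)) (M j m : ℕ) (hN : N' = Lc ^ j * Lc ^ (m + 1)) (c : ℝ)
    (y₀ : Site (d + 1)) :
    symAxProjNestAt ρ Lc (m + 1)
        (fun l y' => c * ∑ i' ∈ LegIdx d (Lc ^ j), blockSum M (Mcol (N := N') l (legPt (Lc ^ j) (Sum.inl l : Fib d) y' i')) y₀) = 0 := by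
  have hK : 1 ≤ Lc ^ j := Nat.one_le_pow _ _ hLc
  have e : (fun l y' => c * ∑ i' ∈ LegIdx d (Lc ^ j), blockSum M (Mcol (N := N') l (legPt (Lc ^ j) (Sum.inl l : Fib d) y' i')) y₀)
      = (-c) • grad (blockSum (Lc ^ j) (fun u => ∑ b ∈ box (d + 1) M, SbCol (N := N') ((M : ℤ) • y₀ + toSite b) u)) := by
    funext l y'
    rw [sum_LegIdx_blockSumMcol_eq_neg_dz, grad_eq_dz]
    simp only [Pi.smul_apply, smul_eq_mul]
    ring
  rw [e, symAxProjNestAt_smul, symAxProjNestAt_grad_eq_zero_of_blockSum hLc ρ (m + 1) (blockSum_blockSum_theta_eq_zero M hK hN y₀), smul_zero]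

/-- [our proof] The same for the WINDOWED MATRIX ACTION of FILE 7 (in-block root): `coProjNestAt (toSite r) Lc (m+1) (c · decimated gauge leg) = 0`. -/
theorem coProjNestAt_decGaugeLeg_eq_zero {Lc : ℕ} (hLc : 1 ≤ Lc) {r : Fin (d + 1) → ℕ} (hr : r ∈ box (d + 1) Lc) (M j m : ℕ)
    (hN : N' = Lc ^ j * Lc ^ (m + 1)) (c : ℝ) (y₀ : Site (d + 1)) (κ' : Fin (d + 1)) (u' : Site (d + 1)) :
    coProjNestAt (toSite r) Lc (m + 1)
        (fun l y' => c * ∑ i' ∈ LegIdx d (Lc ^ j), blockSum M (Mcol (N := N') l (legPt (Lc ^ j) (Sum.inl l : Fib d) y' i')) y₀) κ' u' = 0 := by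
  rw [← symAxProjNestAt_eq_coProjNestAt hLc hr, symAxProjNestAt_decGaugeLeg_eq_zero hLc (toSite r) M j m hN c y₀]
  rfl

end GaugeLeg

/-! ## §2 The finite-`j` bottom defect entry in factorised form under `Σ'_{y₀}` -/

section Algebra

/-- [folklore] Finite algebra: `Σ_i Σ_{i′} c·c·(C₁ i·β₂ i′ + β₁ i·C₂ i′) = (c·Σ C₁)(c·Σ β₂) + (c·Σ β₁)(c·Σ C₂)`. -/
theorem sum_sum_factor {ι : Type*} (s : Finset ι) (c : ℝ) (C₁ β₂ β₁ C₂ : ι → ℝ) :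
    ∑ i ∈ s, ∑ i' ∈ s, c * c * (C₁ i * β₂ i' + β₁ i * C₂ i')
      = (c * ∑ i ∈ s, C₁ i) * (c * ∑ i' ∈ s, β₂ i') + (c * ∑ i ∈ s, β₁ i) * (c * ∑ i' ∈ s, C₂ i') := by
  rw [Finset.mul_sum s C₁ c, Finset.mul_sum s β₂ c, Finset.mul_sum s β₁ c, Finset.mul_sum s C₂ c, Finset.sum_mul_sum, Finset.sum_mul_sum,
    ← Finset.sum_add_distrib]
  refine Finset.sum_congr rfl fun i _ => ?_
  rw [← Finset.sum_add_distrib]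
  exact Finset.sum_congr rfl fun i' _ => by ring

/-- [folklore] Finite algebra: the double window contraction of a sum of two rank-one terms factorises leg by leg. -/
theorem window_factor {ι σ : Type*} [Fintype σ] (V : Finset ι) (P₁ P₂ D₁ B₁ D₂ B₂ : σ → ι → ℝ) :
    ∑ v ∈ V, ∑ κ : σ, ∑ w ∈ V, ∑ l : σ, P₁ κ v * (D₁ κ v * B₂ l w + B₁ κ v * D₂ l w) * P₂ l w
      = (∑ v ∈ V, ∑ κ : σ, P₁ κ v * D₁ κ v) * (∑ w ∈ V, ∑ l : σ, P₂ l w * B₂ l w)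
        + (∑ v ∈ V, ∑ κ : σ, P₁ κ v * B₁ κ v) * (∑ w ∈ V, ∑ l : σ, P₂ l w * D₂ l w) := by
  rw [Finset.sum_mul_sum, Finset.sum_mul_sum, ← Finset.sum_add_distrib]
  refine Finset.sum_congr rfl fun v _ => ?_
  rw [← Finset.sum_add_distrib, Finset.sum_comm]
  refine Finset.sum_congr rfl fun w _ => ?_
  rw [Finset.sum_mul_sum, Finset.sum_mul_sum, ← Finset.sum_add_distrib]
  refine Finset.sum_congr rfl fun κ _ => ?_
  rw [← Finset.sum_add_distrib]
  exact Finset.sum_congr rfl fun l _ => by ring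

end Algebra

section Factorised

variable (Lc : ℕ) [NeZero Lc]

/-- [folklore] Summability in `y₀` of one `(i, i′)` term of the closed form: `C` summable (`TwoLevelDefectClosedForm.summable_C`) × `β` bounded
(`GaugeMultiplierBiLaplace.blockSumMcol_bdd_summable`), both ways round. -/
theorem summable_term {M N' : ℕ} [NeZero M] [NeZero N'] (κ l : Fin (d + 1)) (p q : Site (d + 1)) (c : ℝ) :
    Summable (fun y₀ : Site (d + 1) =>
      c * (codiff₁ (dz (codiff₁ (Gcol (N := M) κ p))) ((M : ℤ) • y₀) * blockSum M (Mcol (N := N') l q) y₀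
            + blockSum M (Mcol (N := N') κ p) y₀ * codiff₁ (dz (codiff₁ (Gcol (N := M) l q))) ((M : ℤ) • y₀))) := by
  obtain ⟨Cβ, _, hβb, _⟩ := blockSumMcol_bdd_summable (N' := N') (d := d) M
  have s1 : Summable (fun y₀ : Site (d + 1) => codiff₁ (dz (codiff₁ (Gcol (N := M) κ p))) ((M : ℤ) • y₀) * blockSum M (Mcol (N := N') l q) y₀) :=
    summable_mul_of_bdd' (summable_C (M := M) κ p) (fun y₀ => hβb y₀ l q)
  have s2 : Summable (fun y₀ : Site (d + 1) => blockSum M (Mcol (N := N') κ p) y₀ * codiff₁ (dz (codiff₁ (Gcol (N := M) l q))) ((M : ℤ) • y₀)) :=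
    summable_mul_of_bdd (fun y₀ => hβb y₀ κ p) (summable_C (M := M) l q)
  exact (s1.add s2).mul_left c

/-- [folklore] **THE FINITE-`j` BOTTOM DEFECT ENTRY, FACTORISED UNDER `Σ'_{y₀}`** (every `d`, `Lc ≥ 1`): with `c := ((Lc^j)^{d+2})⁻¹`, `M := Lc^(j+1)`, `N′ := Lc^(j+1+m)`,
`D_{y₀}(κ,x′) := c · Σ_{i ∈ LegIdx d (Lc^j)} (δdδ Γ_M(·; κ, p_i))(M•y₀)`, `B_{y₀}(l,y′) := c · Σ_{i′} blockSum_M (Mcol_{N′} l q_{i′}) y₀`: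
`E_j(x′,y′;κ,l) = Σ'_{y₀} [D_{y₀}(κ,x′)·B_{y₀}(l,y′) + B_{y₀}(κ,x′)·D_{y₀}(l,y′)]` — gan24-leaf-05's `bareDefectBottom_ff_eq_sum_closedForm` with the finite leg sums taken
inside the absolutely convergent `Σ'_{y₀}`. -/
theorem bareDefectBottom_ff_eq_tsum_factorised (j m : ℕ) (x' y' : Site (d + 1)) (κ l : Fin (d + 1)) :
    KTot (d := d) (Lc ^ (j + 1 + m)) (Lc ^ j) x' y' (Sum.inl κ) (Sum.inl l)
        - (KTot (d := d) (Lc ^ (j + 1)) (Lc ^ j) x' y' (Sum.inl κ) (Sum.inl l)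
          - ((((Lc ^ j : ℕ) : ℝ)) ^ (d + 2) * (((Lc ^ j : ℕ) : ℝ)) ^ (d + 2))
            * comp (KTot (d := d) (Lc ^ (j + 1)) (Lc ^ j))
                (comp (liftW Lc true true (KTot (d := d) (Lc ^ (j + 1 + m)) (Lc ^ (j + 1)))) (KTot (d := d) (Lc ^ (j + 1)) (Lc ^ j)))
                x' y' (Sum.inl κ) (Sum.inl l))
      = ∑' y₀ : Site (d + 1),
          (((((Lc ^ j : ℕ) : ℝ) ^ (d + 2))⁻¹
              * ∑ i ∈ LegIdx d (Lc ^ j), codiff₁ (dz (codiff₁ (Gcol (N := Lc ^ (j + 1)) κ (legPt (Lc ^ j) (Sum.inl κ : Fib d) x' i))))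
                  (((Lc ^ (j + 1) : ℕ) : ℤ) • y₀))
            * ((((Lc ^ j : ℕ) : ℝ) ^ (d + 2))⁻¹
              * ∑ i' ∈ LegIdx d (Lc ^ j), blockSum (Lc ^ (j + 1)) (Mcol (N := Lc ^ (j + 1 + m)) l (legPt (Lc ^ j) (Sum.inl l : Fib d) y' i')) y₀)
          + ((((Lc ^ j : ℕ) : ℝ) ^ (d + 2))⁻¹
              * ∑ i ∈ LegIdx d (Lc ^ j), blockSum (Lc ^ (j + 1)) (Mcol (N := Lc ^ (j + 1 + m)) κ (legPt (Lc ^ j) (Sum.inl κ : Fib d) x' i)) y₀)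
            * ((((Lc ^ j : ℕ) : ℝ) ^ (d + 2))⁻¹
              * ∑ i' ∈ LegIdx d (Lc ^ j), codiff₁ (dz (codiff₁ (Gcol (N := Lc ^ (j + 1)) l (legPt (Lc ^ j) (Sum.inl l : Fib d) y' i'))))
                  (((Lc ^ (j + 1) : ℕ) : ℤ) • y₀))) := by
  rw [bareDefectBottom_ff_eq_sum_closedForm]
  -- abbreviations
  set c : ℝ := (((Lc ^ j : ℕ) : ℝ) ^ (d + 2))⁻¹ with hc
  set C : Fin (d + 1) → Site (d + 1) → ((Fin (d + 1) → ℕ) × ℕ) → Site (d + 1) → ℝ := fun κ x' i y₀ =>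
    codiff₁ (dz (codiff₁ (Gcol (N := Lc ^ (j + 1)) κ (legPt (Lc ^ j) (Sum.inl κ : Fib d) x' i)))) (((Lc ^ (j + 1) : ℕ) : ℤ) • y₀) with hC
  set β : Fin (d + 1) → Site (d + 1) → ((Fin (d + 1) → ℕ) × ℕ) → Site (d + 1) → ℝ := fun l y' i' y₀ =>
    blockSum (Lc ^ (j + 1)) (Mcol (N := Lc ^ (j + 1 + m)) l (legPt (Lc ^ j) (Sum.inl l : Fib d) y' i')) y₀ with hβ
  -- each (i, i') term is summable in y₀
  have hs : ∀ i i', Summable (fun y₀ : Site (d + 1) => c * c * (C κ x' i y₀ * β l y' i' y₀ + β κ x' i y₀ * C l y' i' y₀)) := by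
    intro i i'
    have h := summable_term (d := d) (M := Lc ^ (j + 1)) (N' := Lc ^ (j + 1 + m)) κ l
      (legPt (Lc ^ j) (Sum.inl κ : Fib d) x' i) (legPt (Lc ^ j) (Sum.inl l : Fib d) y' i') (c * c)
    simpa only [hC, hβ] using h
  -- move the finite leg sums inside the tsum
  show ∑ i ∈ LegIdx d (Lc ^ j), ∑ i' ∈ LegIdx d (Lc ^ j), c * c * ∑' y₀ : Site (d + 1), (C κ x' i y₀ * β l y' i' y₀ + β κ x' i y₀ * C l y' i' y₀)
    = ∑' y₀ : Site (d + 1), ((c * ∑ i ∈ LegIdx d (Lc ^ j), C κ x' i y₀) * (c * ∑ i' ∈ LegIdx d (Lc ^ j), β l y' i' y₀)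
        + (c * ∑ i ∈ LegIdx d (Lc ^ j), β κ x' i y₀) * (c * ∑ i' ∈ LegIdx d (Lc ^ j), C l y' i' y₀))
  have e1 : ∀ i i', c * c * ∑' y₀ : Site (d + 1), (C κ x' i y₀ * β l y' i' y₀ + β κ x' i y₀ * C l y' i' y₀)
      = ∑' y₀ : Site (d + 1), c * c * (C κ x' i y₀ * β l y' i' y₀ + β κ x' i y₀ * C l y' i' y₀) := fun i i' => (tsum_mul_left).symm
  simp only [e1]
  rw [Finset.sum_congr rfl fun i _ => (Summable.tsum_finsetSum (fun i' _ => hs i i')).symm,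
    ← Summable.tsum_finsetSum (fun i _ => summable_sum fun i' _ => hs i i')]
  exact tsum_congr fun y₀ => sum_sum_factor _ c _ _ _ _

end Factorised

/-! ## §3 The double window contraction with the nested projector's matrix vanishes at every `j` -/

section Kill

variable (Lc : ℕ) [NeZero Lc]

/-- [our proof] **SPLIT (i-a): THE NESTED PROJECTOR KILLS THE FINITE-`j` BOTTOM TWO-LEVEL DEFECT, ENTRYWISE, AT EVERY `j`** (every `d`, `Lc ≥ 1`, in-block root
`r ∈ box (d+1) Lc`, every `j m x z a b`).  With `P := pmSymNest (toSite r) Lc (m+1)` (the matrix of `Π^{(m+1)}_nest`, FILE 4) and `E_j` the BARE finite-`j` bottom defect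
of `PerfectGaugeDefectBottomLimit.perfectDefectBottom_window_eq_zero_holds` (scalar `((Lc^j)^{d+2})²`):
`Σ_{v ∈ cube (Lc^(m+1))} Σ_κ Σ_{w ∈ cube (Lc^(m+1))} Σ_l P a x κ (x−v) · E_j(x−v, z−w; κ, l) · P b z l (z−w) = 0`.
PROOF: §2 factorises `E_j = Σ'_{y₀} [D⊗B + B⊗D]`; the finite window sums pass inside `Σ'_{y₀}`; for each `y₀` the right contraction `Σ_{w,l} B_{y₀}(l,z−w)·P b z l (z−w)` is
`coProjNestAt (toSite r) Lc (m+1) B_{y₀} b z = 0` and the left one `Σ_{v,κ} P a x κ (x−v)·B_{y₀}(κ,x−v) = coProjNestAt … B_{y₀} a x = 0` (§1, `N′ = Lc^(j+1+m) = Lc^j·Lc^(m+1)`). -/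
theorem window_bareDefectBottom_eq_zero (hLc : 1 ≤ Lc) {r : Fin (d + 1) → ℕ} (hr : r ∈ box (d + 1) Lc) (j m : ℕ) (x z : Site (d + 1))
    (a b : Fin (d + 1)) :
    ∑ v ∈ cube (d + 1) (Lc ^ (m + 1)), ∑ κ : Fin (d + 1), ∑ w ∈ cube (d + 1) (Lc ^ (m + 1)), ∑ l : Fin (d + 1),
        pmSymNest (toSite r) Lc (m + 1) a x κ (x - v)
          * (KTot (d := d) (Lc ^ (j + 1 + m)) (Lc ^ j) (x - v) (z - w) (Sum.inl κ) (Sum.inl l)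
              - (KTot (d := d) (Lc ^ (j + 1)) (Lc ^ j) (x - v) (z - w) (Sum.inl κ) (Sum.inl l)
                - ((((Lc ^ j : ℕ) : ℝ)) ^ (d + 2) * (((Lc ^ j : ℕ) : ℝ)) ^ (d + 2))
                  * comp (KTot (d := d) (Lc ^ (j + 1)) (Lc ^ j))
                      (comp (liftW Lc true true (KTot (d := d) (Lc ^ (j + 1 + m)) (Lc ^ (j + 1)))) (KTot (d := d) (Lc ^ (j + 1)) (Lc ^ j)))
                      (x - v) (z - w) (Sum.inl κ) (Sum.inl l)))
          * pmSymNest (toSite r) Lc (m + 1) b z l (z - w) = 0 := by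
  -- abbreviations (as in §2)
  set c : ℝ := (((Lc ^ j : ℕ) : ℝ) ^ (d + 2))⁻¹ with hc
  set C : Fin (d + 1) → Site (d + 1) → ((Fin (d + 1) → ℕ) × ℕ) → Site (d + 1) → ℝ := fun κ x' i y₀ =>
    codiff₁ (dz (codiff₁ (Gcol (N := Lc ^ (j + 1)) κ (legPt (Lc ^ j) (Sum.inl κ : Fib d) x' i)))) (((Lc ^ (j + 1) : ℕ) : ℤ) • y₀) with hC
  set β : Fin (d + 1) → Site (d + 1) → ((Fin (d + 1) → ℕ) × ℕ) → Site (d + 1) → ℝ := fun l y' i' y₀ =>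
    blockSum (Lc ^ (j + 1)) (Mcol (N := Lc ^ (j + 1 + m)) l (legPt (Lc ^ j) (Sum.inl l : Fib d) y' i')) y₀ with hβ
  set D : Site (d + 1) → Fin (d + 1) → Site (d + 1) → ℝ := fun y₀ κ x' => c * ∑ i ∈ LegIdx d (Lc ^ j), C κ x' i y₀ with hD
  set B : Site (d + 1) → Fin (d + 1) → Site (d + 1) → ℝ := fun y₀ l y' => c * ∑ i' ∈ LegIdx d (Lc ^ j), β l y' i' y₀ with hB
  set P : Fin (d + 1) → Site (d + 1) → Fin (d + 1) → Site (d + 1) → ℝ := fun a x κ q => pmSymNest (toSite r) Lc (m + 1) a x κ q with hP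
  -- §2: the entry is `Σ'_{y₀} (D B + B D)`
  have hE : ∀ (x' y' : Site (d + 1)) (κ l : Fin (d + 1)),
      KTot (d := d) (Lc ^ (j + 1 + m)) (Lc ^ j) x' y' (Sum.inl κ) (Sum.inl l)
        - (KTot (d := d) (Lc ^ (j + 1)) (Lc ^ j) x' y' (Sum.inl κ) (Sum.inl l)
          - ((((Lc ^ j : ℕ) : ℝ)) ^ (d + 2) * (((Lc ^ j : ℕ) : ℝ)) ^ (d + 2))
            * comp (KTot (d := d) (Lc ^ (j + 1)) (Lc ^ j))
                (comp (liftW Lc true true (KTot (d := d) (Lc ^ (j + 1 + m)) (Lc ^ (j + 1)))) (KTot (d := d) (Lc ^ (j + 1)) (Lc ^ j)))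
                x' y' (Sum.inl κ) (Sum.inl l))
      = ∑' y₀ : Site (d + 1), (D y₀ κ x' * B y₀ l y' + B y₀ κ x' * D y₀ l y') := by
    intro x' y' κ l
    have h := bareDefectBottom_ff_eq_tsum_factorised (d := d) Lc j m x' y' κ l
    simpa only [hD, hB, hC, hβ, hc] using h
  -- summability in `y₀` of each window term
  have hsDB : ∀ (x' y' : Site (d + 1)) (κ l : Fin (d + 1)), Summable (fun y₀ => D y₀ κ x' * B y₀ l y' + B y₀ κ x' * D y₀ l y') := by
    intro x' y' κ l
    have hs : ∀ i i', Summable (fun y₀ : Site (d + 1) => c * c * (C κ x' i y₀ * β l y' i' y₀ + β κ x' i y₀ * C l y' i' y₀)) := by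
      intro i i'
      have h := summable_term (d := d) (M := Lc ^ (j + 1)) (N' := Lc ^ (j + 1 + m)) κ l
        (legPt (Lc ^ j) (Sum.inl κ : Fib d) x' i) (legPt (Lc ^ j) (Sum.inl l : Fib d) y' i') (c * c)
      simpa only [hC, hβ] using h
    have h := summable_sum (s := LegIdx d (Lc ^ j)) fun i _ => summable_sum (s := LegIdx d (Lc ^ j)) fun i' _ => hs i i'
    refine h.congr fun y₀ => ?_
    simp only [hD, hB]
    exact sum_sum_factor _ c _ _ _ _
  -- §1: both one-leg contractions of `B_{y₀}` with the matrix vanish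
  have hN : Lc ^ (j + 1 + m) = Lc ^ j * Lc ^ (m + 1) := by rw [← pow_add]; congr 1; omega
  have killR : ∀ (y₀ : Site (d + 1)) (κ' : Fin (d + 1)) (u' : Site (d + 1)),
      ∑ w ∈ cube (d + 1) (Lc ^ (m + 1)), ∑ l : Fin (d + 1), P κ' u' l (u' - w) * B y₀ l (u' - w) = 0 := by
    intro y₀ κ' u'
    have h := coProjNestAt_decGaugeLeg_eq_zero (N' := Lc ^ (j + 1 + m)) hLc hr (Lc ^ (j + 1)) j m hN c y₀ κ' u'
    simpa only [coProjNestAt, hP, hB, hβ] using h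
  -- rewrite the window sum as `Σ'_{y₀}` of the `y₀`-terms, each of which vanishes
  simp only [hE]
  have step : ∀ (v : Site (d + 1)) (κ : Fin (d + 1)) (w : Site (d + 1)) (l : Fin (d + 1)),
      P a x κ (x - v) * (∑' y₀ : Site (d + 1), (D y₀ κ (x - v) * B y₀ l (z - w) + B y₀ κ (x - v) * D y₀ l (z - w))) * P b z l (z - w)
        = ∑' y₀ : Site (d + 1), P a x κ (x - v) * (D y₀ κ (x - v) * B y₀ l (z - w) + B y₀ κ (x - v) * D y₀ l (z - w)) * P b z l (z - w) := by
    intro v κ w l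
    rw [← tsum_mul_left, ← tsum_mul_right]
  have hsT : ∀ (v : Site (d + 1)) (κ : Fin (d + 1)) (w : Site (d + 1)) (l : Fin (d + 1)),
      Summable (fun y₀ : Site (d + 1) => P a x κ (x - v) * (D y₀ κ (x - v) * B y₀ l (z - w) + B y₀ κ (x - v) * D y₀ l (z - w)) * P b z l (z - w)) :=
    fun v κ w l => ((hsDB (x - v) (z - w) κ l).mul_left _).mul_right _
  show ∑ v ∈ cube (d + 1) (Lc ^ (m + 1)), ∑ κ : Fin (d + 1), ∑ w ∈ cube (d + 1) (Lc ^ (m + 1)), ∑ l : Fin (d + 1),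
      P a x κ (x - v) * (∑' y₀ : Site (d + 1), (D y₀ κ (x - v) * B y₀ l (z - w) + B y₀ κ (x - v) * D y₀ l (z - w))) * P b z l (z - w) = 0
  simp only [step]
  -- interchange the four finite sums with the tsum
  rw [Finset.sum_congr rfl fun v _ => Finset.sum_congr rfl fun κ _ => Finset.sum_congr rfl fun w _ =>
      (Summable.tsum_finsetSum (fun l _ => hsT v κ w l)).symm,
    Finset.sum_congr rfl fun v _ => Finset.sum_congr rfl fun κ _ =>
      (Summable.tsum_finsetSum (fun w _ => summable_sum fun l _ => hsT v κ w l)).symm,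
    Finset.sum_congr rfl fun v _ =>
      (Summable.tsum_finsetSum (fun κ _ => summable_sum fun w _ => summable_sum fun l _ => hsT v κ w l)).symm,
    ← Summable.tsum_finsetSum (fun v _ => summable_sum fun κ _ => summable_sum fun w _ => summable_sum fun l _ => hsT v κ w l)]
  -- each `y₀`-term vanishes
  refine (tsum_congr fun y₀ => ?_).trans tsum_zero
  have expand := window_factor (cube (d + 1) (Lc ^ (m + 1))) (fun κ v => P a x κ (x - v)) (fun l w => P b z l (z - w))
    (fun κ v => D y₀ κ (x - v)) (fun κ v => B y₀ κ (x - v)) (fun l w => D y₀ l (z - w)) (fun l w => B y₀ l (z - w))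
  rw [expand, killR y₀ b z, killR y₀ a x, mul_zero, zero_mul, add_zero]

end Kill

/-! ## §4 In the `comp (comp (trK Π) ·) Π` currency: every finite `j`, and the PERFECT bottom defect (SPLIT (i) closed, `d + 1 = 4`) -/

section Comp

variable (Lc : ℕ) [NeZero Lc]

/-- [our proof] **THE CO-DRESSED FINITE-`j` BOTTOM DEFECT VANISHES IN THE FIELD–FIELD BLOCK, AT EVERY `j`** (every `d`, `Lc ≥ 1`, in-block root): with
`Π := piKSymNest (toSite r) Lc (m+1)` and `E_j` the bare finite-`j` bottom defect AS A KERNEL (pointwise `−` ∕ `•`, scalar `((Lc^j)^{d+2})²`),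
`[Πᵀ∘E_j∘Π](x, z; inl a, inl b) = 0` — gan24-leaf-05's `coDressNest_ff_apply` + §3. -/
theorem coDressNest_bareDefectBottom_ff_eq_zero (hLc : 1 ≤ Lc) {r : Fin (d + 1) → ℕ} (hr : r ∈ box (d + 1) Lc) (j m : ℕ)
    (x z : Site (d + 1)) (a b : Fin (d + 1)) :
    comp (comp (trK (piKSymNest (toSite r) Lc (m + 1)))
        (KTot (d := d) (Lc ^ (j + 1 + m)) (Lc ^ j)
          - (KTot (d := d) (Lc ^ (j + 1)) (Lc ^ j)
            - ((((Lc ^ j : ℕ) : ℝ)) ^ (d + 2) * (((Lc ^ j : ℕ) : ℝ)) ^ (d + 2))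
              • comp (KTot (d := d) (Lc ^ (j + 1)) (Lc ^ j))
                  (comp (liftW Lc true true (KTot (d := d) (Lc ^ (j + 1 + m)) (Lc ^ (j + 1)))) (KTot (d := d) (Lc ^ (j + 1)) (Lc ^ j))))))
      (piKSymNest (toSite r) Lc (m + 1)) x z (Sum.inl a) (Sum.inl b) = 0 := by
  rw [coDressNest_ff_apply]
  simp only [Pi.sub_apply, Pi.smul_apply, smul_eq_mul]
  exact window_bareDefectBottom_eq_zero Lc hLc hr j m x z a b

/-- [our proof] **SPLIT (i) CLOSED IN THE FIELD–FIELD BLOCK: THE NESTED PROJECTOR KILLS THE PERFECT BOTTOM TWO-LEVEL DEFECT `E♭_m`, ENTRYWISE, UNCONDITIONALLY**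
(`d + 1 = 4`, `Lc ≥ 2`, `m ≥ 1`, in-block root `r ∈ box 4 Lc`): for `Π := piKSymNest (toSite r) Lc (m+1)` and the owner's `PerfectGaugeDefectBottom` bracket
`E♭_m := KPerf (m+1) − (KPerf 1 − (Lc·Lc)⁻¹ • KPerf 1 ∘ liftW Lc true true (KPerf m) ∘ KPerf 1)` (road units `sfStep`∕`smStep`),
`[Πᵀ∘E♭_m∘Π](x, z; inl a, inl b) = 0` — gan24-leaf-05's `coDressNest_perfectDefectBottom_ff_eq_zero_holds` (SPLIT (i-b)) with its `h0` supplied AT EVERY `j` by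
`coDressNest_bareDefectBottom_ff_eq_zero` (SPLIT (i-a)).  Memo §11 (11b) (i) «`Π·E♭_m·Πᵀ = 0` ENTRYWISE» for the ff block. -/
theorem coDressNest_perfectDefectBottom_ff_eq_zero (hLc : 2 ≤ Lc) {m : ℕ} (hm : 1 ≤ m) {r : Fin (3 + 1) → ℕ} (hr : r ∈ box (3 + 1) Lc)
    (x z : Site (3 + 1)) (a b : Fin (3 + 1)) :
    comp (comp (trK (piKSymNest (toSite r) Lc (m + 1)))
        (KPerf (d := 3) Lc (sfStep Lc) (smStep 3 Lc) (m + 1)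
          - (KPerf (d := 3) Lc (sfStep Lc) (smStep 3 Lc) 1
            - (((Lc : ℝ)) * ((Lc : ℝ)))⁻¹
              • comp (KPerf (d := 3) Lc (sfStep Lc) (smStep 3 Lc) 1)
                  (comp (liftW Lc true true (KPerf (d := 3) Lc (sfStep Lc) (smStep 3 Lc) m)) (KPerf (d := 3) Lc (sfStep Lc) (smStep 3 Lc) 1)))))
      (piKSymNest (toSite r) Lc (m + 1)) x z (Sum.inl a) (Sum.inl b) = 0 :=
  coDressNest_perfectDefectBottom_ff_eq_zero_holds Lc hLc hm (toSite r) (m + 1) x z a b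
    (Eventually.of_forall fun j => coDressNest_bareDefectBottom_ff_eq_zero Lc (by omega) hr j m x z a b)

end Comp

end Summit.QuantumFields.BalabanUV.Beta.FP.NestedDressingDefectKill

end
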